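import Mathlib
import HarnessLib

/-!
# The `O(2)` critical-exponent dictionary and the exact arithmetic of the `λ`-point comparison

Chester–Landry–Liu–Poland–Simmons-Duffin–Su–Vichi, *Carving out OPE space and precise O(2) model
critical exponents*, JHEP 06 (2020) 142 [arXiv:1912.03324], §1.2: *"Critical exponents are linked
to operator dimensions at the fixed point by the simple relations `Δ_φ = (1+η)/2`, `Δ_s = 3 − 1/ν`.
Here, `s ∼ |φ⃗|²` denotes the lowest-dimension charge-0 scalar."*  §1.2.1: *"by fitting measurements
from the λ-point experiment, the following value of the critical exponent `ν` was obtained: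
`ν^EXP = 0.6709(1)`"*; §1.2.2: *"`ν^MC = 0.67169(7)`"* [Hasenbusch 2019], *"`ν^{MC+HT} = 0.6717(1)`"*
[Campostrini–Hasenbusch–Pelissetto–Vicari 2006], *"a large discrepancy of approximatively `8σ`"*.
§4.2 (`Λ = 43`, OPE scan): *"the conformal bootstrap results exclude the values of `Δ_s` extracted
from ⁴He measurements"*; the "best-fit" region *"gives the determinations `Δ_φ = 0.519088(17*)`,
`Δ_s = 1.51136(18*)`, `Δ_t = 1.23629(9*)`.  More conservatively we can consider the convex hull of the
disallowed points in the Delaunay triangles straddling the boundary of the allowed region.  We believe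
that every point outside of this more conservative region is excluded by the conformal bootstrap,
giving the rigorous error bars `Δ_φ = 0.519088(22)`, `Δ_s = 1.51136(22)`, `Δ_t = 1.23629(11)`."*
The experimental PRIMARY is Lipa–Nissen–Stricker–Swanson–Chui, PRB 68 (2003) 174518, abstract and
conclusions: *"`α = −0.0127 ± 0.0003`"* — the printed quantity is the specific-heat exponent `α`;
`ν^EXP = 0.6709(1)` is its image under hyperscaling, Hasenbusch, arXiv:2507.19265, §1: *"`α = −0.0127(3)`,
which corresponds to `ν = (2−α)/d = 0.6709(1)`, exploiting the hyperscaling relation"*; the same paper's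
abstract gives the newest lattice values *"`η = 0.03816(2)` and `y_t = 1/ν = 1.48872(5)`"*.
Rychkov–Su, Rev. Mod. Phys. 96 (2024) 045004, §4.2: *"The found `Δ_s` translates into the critical
exponent `ν` from the conformal bootstrap: `ν^CB = 0.671754(99)`"*, with the footnote *"there are some
other sources of 'error in the error' which are not fully rigorous … conformal block derivatives are
replaced by their rational approximations when passing to an SDP … Another non-rigorous error comes
from the Delaunay triangulation method and the heuristics in the cutting surface algorithm not being
completely rigorous."*

WHAT THIS FILE IS.  The sentence *"a certified bootstrap island places `ν` in `[a, b]`; the λ-point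
value lies inside / outside"* has three ingredients of different standing, and this file separates
them and does the third exactly:

1. THE DICTIONARY (§1): `dimOfNu ν = 3 − 1/ν`, `nuOfDim Δ_s = 1/(3 − Δ_s)`, `dimOfEta η = (1+η)/2`,
   `etaOfDim Δ_φ = 2Δ_φ − 1`, hyperscaling `nuOfAlpha α = (2 − α)/3`, `alphaOfNu ν = 2 − 3ν`, and the
   composites `dimOfAlpha α = 3 − 3/(2 − α)`, `alphaOfDim Δ_s = 2 − 3/(3 − Δ_s)` — DEFINITIONS, with
   their inverse relations and (strict) monotonicity on the physical domains (`ν > 0`, `Δ_s < 3`,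
   `α < 2`) and the interval-image lemmas a comparison needs (`nuOfDim_mem_Icc`, `dimOfAlpha_mem_Icc`,
   …).  That the exponents of the λ-transition of ⁴He ARE these functions of the dimensions of an
   `O(2)`-invariant unitary 3d CFT is the physical identification of the universality class — a
   hypothesis wherever it is used below, never a theorem.
2. THE PRINTED NUMBERS (§2) as exact decimal intervals, `c(r) ↦ Icc (c − r) (c + r)`:
   `chesterIsland43` (the "rigorous error bars" box, coordinates `(Δ_s, Δ_φ, Δ_t)` in the order used by
   `O2ThreeScalarSystem.O2Enclosure`), `chesterIsland43BestFit`, `autobootBox25` (Go–Tachikawa's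
   `Λ = 25` bounds), `alphaEXP`, `nuEXP`, `nuMC2019`, `nuMCHT2006`, `ytMC2025`, `etaMC2025`.  These are
   TRANSCRIPTIONS of published claims.  In particular `chesterIsland43` is the outcome of a
   floating-point computation (SDPB at `Λ = 43`, Delaunay search, cutting-surface heuristics — the
   Rychkov–Su footnote above names exactly the non-rigorous steps); membership of the physical
   dimensions in it is a HYPOTHESIS (`hD : D ∈ chesterIsland43`) in every statement of §3–§4, to be
   discharged only by a certified enclosure (none exists in print or in this library).
3. THE EXACT ARITHMETIC (§3), all by `norm_num` on rationals through the monotone dictionary: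
   the two printed forms of the experiment agree (`nuOfAlpha_image_alphaEXP : nuOfAlpha '' alphaEXP =
   nuEXP`); the λ-point in dimension units `dimOfAlpha '' alphaEXP ⊆ [1.50924, 1.50969]`; the island in
   exponent units `ν ∈ [0.67165, 0.67186]` (the printed `0.671754(99)`), `α ∈ [−0.01557, −0.01496]`,
   `η ∈ [0.038132, 0.03822]`; SEPARATION: every `Δ_s` of the island exceeds every λ-point `Δ_s` by at
   least `0.00145` (`lambdaPoint_gap`; `6.5` experimental standard deviations in `Δ_s` units), the
   island's `Δ_s`-shadow and `dimOfAlpha '' alphaEXP` are disjoint, and an `α` whose `Δ_s` lies in the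
   shadow is `< α^EXP − 7σ^EXP` (`alpha_lt_of_dimOfAlpha_mem`; the printed "≈ 8σ" is `7.5σ` at the
   shadow's near edge); COMPATIBILITY: the 2025 lattice values sit inside the island's shadows
   (`islandDimS_of_ytMC2025`, `etaMC2025_subset`), the 2019 and 2006 Monte-Carlo `ν`-intervals meet
   it; and the `Λ = 25` box WITHOUT OPE scan contains the whole λ-point `Δ_s`-interval
   (`lambdaPoint_subset_autobootBox25`) — those bounds alone exclude nothing, which is why the
   comparison needs the OPE-scan machinery (`OPESpaceCoverCertificate`, `O2ThreeScalarSystem`).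
4. THE VERDICT SHAPE (§4): `verdict_of_enclosure` — from ANY statement of the form
   *"every datum obeying the assumptions with dimensions in the window `W` has dimensions in
   `chesterIsland43`"* (literally the shape of `O2ThreeScalarSystem.O2Enclosure A W chesterIsland43`,
   not imported here so that this file depends on Mathlib only), plus the two physical hypotheses
   (the λ-transition's critical theory obeys the assumptions; its dimensions lie in `W`), conclude
   `ν ∈ [0.67165, 0.67186]`, `ν ∉ nuEXP`, `α ∉ alphaEXP`.  The proof is three lines; the point of
   stating it is to fix, once, which clause is certified mathematics (the enclosure and §3), which is
   transcription (§2) and which is physics (the two hypotheses).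
5. THE ONE-SIDED VERDICT (§5): `nuOfDim_lt_of_exclusion` — from a statement of the form *"no datum
   obeying the assumptions with dimensions in `W` has `Δ_s ≤ c`"* (the shape of
   `O2ThreeScalarSystem.BoxExcluded A {D ∈ W | D.1 ≤ c}`) conclude `ν > 1/(3 − c)`; with the two
   thresholds `threshold_one_sigma` (`c = 1.5097`: `1/(3 − c) > 0.6710 = ν^EXP + σ`) and
   `threshold_three_sigma` (`c = 1.51014`: `> 0.6712`), and `alpha_not_mem_of_exclusion` (`c ≥ 1.50969`
   already separates from `alphaEXP`).
6. THE THIRD COORDINATE (§6): `rgOfDim Δ = 3 − Δ`; the island's `Δ_t`-shadow `islandDimT` maps onto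
   the printed bootstrap `Y₂ = 1.76371(11)` exactly (`rgOfDim_image_islandDimT`) and lies inside the
   Monte-Carlo `Y₂ = 1.7639(11)` (`rgOfDim_mem_y2MC2011`, `y2_mem_of_enclosure`) — consistency, no
   tension, in that coordinate.

HONEST LIMITS.  No conformal field theory, crossing equation, conformal block or functional occurs in
this file; it certifies no exclusion and produces no number of record.  The scaling relations are
taken as definitions of the dictionary, not derived.  The decimal outer bounds in §3 are roundings
OUTWARD of the exact rational endpoints (e.g. `1/(3 − 1.51114) = 0.6716548…` is reported as
`≥ 0.67165`), chosen so that `norm_num` proves them; they are not new determinations of anything.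

## References

* S. M. Chester, W. Landry, J. Liu, D. Poland, D. Simmons-Duffin, N. Su, A. Vichi, *Carving out OPE
  space and precise O(2) model critical exponents*, JHEP 06 (2020) 142. [ChesterEtAl2020]
* J. A. Lipa, J. A. Nissen, D. A. Stricker, D. R. Swanson, T. C. P. Chui, *Specific heat of liquid
  helium in zero gravity very near the lambda point*, Phys. Rev. B 68 (2003) 174518. [LipaEtAl2003]
* M. Hasenbusch, *Monte Carlo study of an improved clock model in three dimensions*, Phys. Rev. B 100
  (2019) 224517. [Hasenbusch2019]
* M. Hasenbusch, *Eliminating leading and subleading corrections to scaling in the three-dimensional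
  XY universality class*, arXiv:2507.19265 (2025). [Hasenbusch2025]
* S. Rychkov, N. Su, *New developments in the numerical conformal bootstrap*, Rev. Mod. Phys. 96
  (2024) 045004. [RychkovSu2024]
* M. Go, Y. Tachikawa, *autoboot: a generator of bootstrap equations with global symmetry*, JHEP 06
  (2019) 084. [GoTachikawa2019]
-/

noncomputable section

open Set

namespace Literature.MathematicalPhysics.QuantumFieldTheory.O2CriticalExponents

/-! ## §1. The dictionary between operator dimensions and critical exponents (`d = 3`) -/

/-- `Δ_s = 3 − 1/ν` (the charge-0 scalar `s` and the correlation-length exponent).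
[cite: ChesterEtAl2020, §1.2 (relations `Δ_φ = (1+η)/2`, `Δ_s = 3 − 1/ν`)] -/
def dimOfNu (ν : ℝ) : ℝ := 3 - 1 / ν

/-- `ν = 1/(3 − Δ_s)`, the inverse of `Δ_s = 3 − 1/ν` (`3 − Δ_s = y_t = 1/ν`).
[cite: ChesterEtAl2020, §1.2 (relation `Δ_s = 3 − 1/ν`)]
[cite: RychkovSu2024, §4.2 ("The found `Δ_s` translates into the critical exponent `ν`")] -/
def nuOfDim (Δs : ℝ) : ℝ := 1 / (3 - Δs)

/-- `Δ_φ = (1 + η)/2` (the order-parameter field and the anomalous dimension).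
[cite: ChesterEtAl2020, §1.2 (relation `Δ_φ = (1+η)/2`)] -/
def dimOfEta (η : ℝ) : ℝ := (1 + η) / 2

/-- `η = 2Δ_φ − 1`, the inverse of `Δ_φ = (1+η)/2`.
[cite: ChesterEtAl2020, §1.2 (relation `Δ_φ = (1+η)/2`)] -/
def etaOfDim (Δφ : ℝ) : ℝ := 2 * Δφ - 1

/-- Hyperscaling in `d = 3`: `ν = (2 − α)/3`.
[cite: Hasenbusch2025, §1 (`ν = (2−α)/d`, "exploiting the hyperscaling relation")] -/
def nuOfAlpha (α : ℝ) : ℝ := (2 - α) / 3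

/-- Hyperscaling in `d = 3`, solved for `α`: `α = 2 − 3ν`.
[cite: Hasenbusch2025, §1 (`ν = (2−α)/d`)] -/
def alphaOfNu (ν : ℝ) : ℝ := 2 - 3 * ν

/-- The composite `α ↦ Δ_s = 3 − 1/ν = 3 − 3/(2 − α)`.
[cite: ChesterEtAl2020, §1.2 (relation `Δ_s = 3 − 1/ν`)] [cite: Hasenbusch2025, §1 (`ν = (2−α)/d`)] -/
def dimOfAlpha (α : ℝ) : ℝ := 3 - 3 / (2 - α)

/-- The composite `Δ_s ↦ α = 2 − 3ν = 2 − 3/(3 − Δ_s)`.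
[cite: ChesterEtAl2020, §1.2 (relation `Δ_s = 3 − 1/ν`)] [cite: Hasenbusch2025, §1 (`ν = (2−α)/d`)] -/
def alphaOfDim (Δs : ℝ) : ℝ := 2 - 3 / (3 - Δs)

/-! ### Inverse relations -/

/-- [cite: ChesterEtAl2020, §1.2 (relation `Δ_s = 3 − 1/ν`)] -/
theorem nuOfDim_dimOfNu (ν : ℝ) : nuOfDim (dimOfNu ν) = ν := by
  simp only [nuOfDim, dimOfNu, sub_sub_cancel, one_div_one_div]

/-- [cite: ChesterEtAl2020, §1.2 (relation `Δ_s = 3 − 1/ν`)] -/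
theorem dimOfNu_nuOfDim (Δs : ℝ) : dimOfNu (nuOfDim Δs) = Δs := by
  simp only [nuOfDim, dimOfNu, one_div_one_div, sub_sub_cancel]

/-- `Δ_s = 3 − y_t` when `ν = 1/y_t`. [cite: Hasenbusch2025, abstract (`y_t = 1/ν`)] -/
theorem dimOfNu_one_div (yt : ℝ) : dimOfNu (1 / yt) = 3 - yt := by
  simp only [dimOfNu, one_div_one_div]

/-- [cite: ChesterEtAl2020, §1.2 (relation `Δ_φ = (1+η)/2`)] -/
theorem etaOfDim_dimOfEta (η : ℝ) : etaOfDim (dimOfEta η) = η := by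
  simp only [etaOfDim, dimOfEta]; ring

/-- [cite: ChesterEtAl2020, §1.2 (relation `Δ_φ = (1+η)/2`)] -/
theorem dimOfEta_etaOfDim (Δφ : ℝ) : dimOfEta (etaOfDim Δφ) = Δφ := by
  simp only [etaOfDim, dimOfEta]; ring

/-- [cite: Hasenbusch2025, §1 (`ν = (2−α)/d`)] -/
theorem alphaOfNu_nuOfAlpha (α : ℝ) : alphaOfNu (nuOfAlpha α) = α := by
  simp only [alphaOfNu, nuOfAlpha]; ring

/-- [cite: Hasenbusch2025, §1 (`ν = (2−α)/d`)] -/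
theorem nuOfAlpha_alphaOfNu (ν : ℝ) : nuOfAlpha (alphaOfNu ν) = ν := by
  simp only [alphaOfNu, nuOfAlpha]; ring

/-- `dimOfAlpha = dimOfNu ∘ nuOfAlpha`. [cite: ChesterEtAl2020, §1.2 (relation `Δ_s = 3 − 1/ν`)] -/
theorem dimOfAlpha_eq (α : ℝ) : dimOfAlpha α = dimOfNu (nuOfAlpha α) := by
  simp only [dimOfAlpha, dimOfNu, nuOfAlpha, one_div_div]

/-- `alphaOfDim = alphaOfNu ∘ nuOfDim`. [cite: Hasenbusch2025, §1 (`ν = (2−α)/d`)] -/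
theorem alphaOfDim_eq (Δs : ℝ) : alphaOfDim Δs = alphaOfNu (nuOfDim Δs) := by
  simp only [alphaOfDim, alphaOfNu, nuOfDim]; ring

/-- [cite: ChesterEtAl2020, §1.2 (relation `Δ_s = 3 − 1/ν`)] [cite: Hasenbusch2025, §1 (`ν = (2−α)/d`)] -/
theorem alphaOfDim_dimOfAlpha {α : ℝ} (hα : α ≠ 2) : alphaOfDim (dimOfAlpha α) = α := by
  have h : (2 : ℝ) - α ≠ 0 := sub_ne_zero.mpr (Ne.symm hα)
  simp only [alphaOfDim, dimOfAlpha]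
  field_simp
  ring

/-- [cite: ChesterEtAl2020, §1.2 (relation `Δ_s = 3 − 1/ν`)] [cite: Hasenbusch2025, §1 (`ν = (2−α)/d`)] -/
theorem dimOfAlpha_alphaOfDim {Δs : ℝ} (h : Δs ≠ 3) : dimOfAlpha (alphaOfDim Δs) = Δs := by
  have h' : (3 : ℝ) - Δs ≠ 0 := sub_ne_zero.mpr (Ne.symm h)
  simp only [alphaOfDim, dimOfAlpha]
  field_simp
  ring

/-! ### Monotonicity on the physical domains and interval images -/

/-- `Δ_s ↦ ν = 1/(3 − Δ_s)` is strictly increasing on `Δ_s < 3`.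
[cite: ChesterEtAl2020, §1.2 (relation `Δ_s = 3 − 1/ν`)] -/
theorem nuOfDim_strictMonoOn : StrictMonoOn nuOfDim (Iio 3) := by
  intro a _ b hb hab
  simp only [nuOfDim]
  exact one_div_lt_one_div_of_lt (sub_pos.mpr hb) (by linarith)

/-- `ν ↦ Δ_s = 3 − 1/ν` is strictly increasing on `ν > 0`.
[cite: ChesterEtAl2020, §1.2 (relation `Δ_s = 3 − 1/ν`)] -/
theorem dimOfNu_strictMonoOn : StrictMonoOn dimOfNu (Ioi 0) := by
  intro a ha b _ hab
  simp only [dimOfNu]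
  have := one_div_lt_one_div_of_lt (show (0 : ℝ) < a from ha) hab
  linarith

/-- `Δ_φ ↦ η = 2Δ_φ − 1` is strictly increasing. [cite: ChesterEtAl2020, §1.2 (relation `Δ_φ = (1+η)/2`)] -/
theorem etaOfDim_strictMono : StrictMono etaOfDim := by
  intro a b hab
  simp only [etaOfDim]
  linarith

/-- `α ↦ Δ_s = 3 − 3/(2 − α)` is strictly decreasing on `α < 2`.
[cite: ChesterEtAl2020, §1.2 (relation `Δ_s = 3 − 1/ν`)] [cite: Hasenbusch2025, §1 (`ν = (2−α)/d`)] -/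
theorem dimOfAlpha_strictAntiOn : StrictAntiOn dimOfAlpha (Iio 2) := by
  intro a _ b hb hab
  simp only [dimOfAlpha]
  have h := div_lt_div_of_pos_left (show (0 : ℝ) < 3 by norm_num) (sub_pos.mpr hb)
    (show (2 : ℝ) - b < 2 - a by linarith)
  linarith

/-- `Δ_s ↦ α = 2 − 3/(3 − Δ_s)` is strictly decreasing on `Δ_s < 3`.
[cite: ChesterEtAl2020, §1.2 (relation `Δ_s = 3 − 1/ν`)] [cite: Hasenbusch2025, §1 (`ν = (2−α)/d`)] -/
theorem alphaOfDim_strictAntiOn : StrictAntiOn alphaOfDim (Iio 3) := by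
  intro a _ b hb hab
  simp only [alphaOfDim]
  have h := div_lt_div_of_pos_left (show (0 : ℝ) < 3 by norm_num) (sub_pos.mpr hb)
    (show (3 : ℝ) - b < 3 - a by linarith)
  linarith

/-- Image of a `Δ_s`-interval below `3` under `ν = 1/(3 − Δ_s)`.
[cite: RychkovSu2024, §4.2 ("The found `Δ_s` translates into the critical exponent `ν`")] -/
theorem nuOfDim_mem_Icc {a b Δs : ℝ} (hb : b < 3) (h : Δs ∈ Icc a b) :
    nuOfDim Δs ∈ Icc (nuOfDim a) (nuOfDim b) := by
  have hm := nuOfDim_strictMonoOn.monotoneOn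
  have hΔ : Δs ∈ Iio (3 : ℝ) := lt_of_le_of_lt h.2 hb
  have ha : a ∈ Iio (3 : ℝ) := lt_of_le_of_lt (h.1.trans h.2) hb
  exact ⟨hm ha hΔ h.1, hm hΔ hb h.2⟩

/-- Image of a positive `ν`-interval under `Δ_s = 3 − 1/ν`.
[cite: ChesterEtAl2020, §1.2 (relation `Δ_s = 3 − 1/ν`)] -/
theorem dimOfNu_mem_Icc {a b ν : ℝ} (ha : 0 < a) (h : ν ∈ Icc a b) :
    dimOfNu ν ∈ Icc (dimOfNu a) (dimOfNu b) := by
  have hm := dimOfNu_strictMonoOn.monotoneOn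
  have hν : ν ∈ Ioi (0 : ℝ) := lt_of_lt_of_le ha h.1
  have hb : b ∈ Ioi (0 : ℝ) := lt_of_lt_of_le ha (h.1.trans h.2)
  exact ⟨hm ha hν h.1, hm hν hb h.2⟩

/-- Image of an `α`-interval below `2` under `Δ_s = 3 − 3/(2 − α)` (order-reversing).
[cite: Hasenbusch2025, §1 (`ν = (2−α)/d`)] -/
theorem dimOfAlpha_mem_Icc {a b α : ℝ} (hb : b < 2) (h : α ∈ Icc a b) :
    dimOfAlpha α ∈ Icc (dimOfAlpha b) (dimOfAlpha a) := by
  have hm := dimOfAlpha_strictAntiOn.antitoneOn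
  have hα : α ∈ Iio (2 : ℝ) := lt_of_le_of_lt h.2 hb
  have ha : a ∈ Iio (2 : ℝ) := lt_of_le_of_lt (h.1.trans h.2) hb
  exact ⟨hm hα hb h.2, hm ha hα h.1⟩

/-- Image of a `Δ_s`-interval below `3` under `α = 2 − 3/(3 − Δ_s)` (order-reversing).
[cite: Hasenbusch2025, §1 (`ν = (2−α)/d`)] -/
theorem alphaOfDim_mem_Icc {a b Δs : ℝ} (hb : b < 3) (h : Δs ∈ Icc a b) :
    alphaOfDim Δs ∈ Icc (alphaOfDim b) (alphaOfDim a) := by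
  have hm := alphaOfDim_strictAntiOn.antitoneOn
  have hΔ : Δs ∈ Iio (3 : ℝ) := lt_of_le_of_lt h.2 hb
  have ha : a ∈ Iio (3 : ℝ) := lt_of_le_of_lt (h.1.trans h.2) hb
  exact ⟨hm hΔ hb h.2, hm ha hΔ h.1⟩

/-- Image of a `Δ_φ`-interval under `η = 2Δ_φ − 1`. [cite: ChesterEtAl2020, §1.2 (relation `Δ_φ = (1+η)/2`)] -/
theorem etaOfDim_mem_Icc {a b Δφ : ℝ} (h : Δφ ∈ Icc a b) :
    etaOfDim Δφ ∈ Icc (etaOfDim a) (etaOfDim b) :=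
  ⟨etaOfDim_strictMono.monotone h.1, etaOfDim_strictMono.monotone h.2⟩

/-! ## §2. The printed numbers, as exact decimal intervals (`c(r)` ↦ `[c − r, c + r]`) -/

/-- The `Λ = 43` island with "rigorous error bars", as the box of triples `(Δ_s, Δ_φ, Δ_t)`:
`Δ_s = 1.51136(22)`, `Δ_φ = 0.519088(22)`, `Δ_t = 1.23629(11)` — *"the convex hull of the disallowed
points in the Delaunay triangles straddling the boundary … We believe that every point outside of this
more conservative region is excluded"*.  A transcription of a floating-point result, not a certificate.
[cite: ChesterEtAl2020, §4.2 ("rigorous error bars" `Δ_φ = 0.519088(22)`, `Δ_s = 1.51136(22)`, `Δ_t = 1.23629(11)`)] -/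
def chesterIsland43 : Set (ℝ × ℝ × ℝ) :=
  {D | D.1 ∈ Icc (1.51136 - 0.00022) (1.51136 + 0.00022) ∧
       D.2.1 ∈ Icc (0.519088 - 0.000022) (0.519088 + 0.000022) ∧
       D.2.2 ∈ Icc (1.23629 - 0.00011) (1.23629 + 0.00011)}

/-- The `Λ = 43` "best-fit" determinations `Δ_s = 1.51136(18*)`, `Δ_φ = 0.519088(17*)`,
`Δ_t = 1.23629(9*)` (order `(Δ_s, Δ_φ, Δ_t)`), *"midway between the allowed and disallowed vertices"* —
the authors' best estimate, explicitly NOT their conservative region.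
[cite: ChesterEtAl2020, §4.2 ("best-fit" `Δ_φ = 0.519088(17*)`, `Δ_s = 1.51136(18*)`, `Δ_t = 1.23629(9*)`)] -/
def chesterIsland43BestFit : Set (ℝ × ℝ × ℝ) :=
  {D | D.1 ∈ Icc (1.51136 - 0.00018) (1.51136 + 0.00018) ∧
       D.2.1 ∈ Icc (0.519088 - 0.000017) (0.519088 + 0.000017) ∧
       D.2.2 ∈ Icc (1.23629 - 0.00009) (1.23629 + 0.00009)}

/-- The `Δ_s`-shadow of `chesterIsland43`: `Δ_s = 1.51136(22)`.
[cite: ChesterEtAl2020, §4.2 ("rigorous error bars" `Δ_s = 1.51136(22)`)] -/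
def islandDimS : Set ℝ := Icc (1.51136 - 0.00022) (1.51136 + 0.00022)

/-- The `Δ_φ`-shadow of `chesterIsland43`: `Δ_φ = 0.519088(22)`.
[cite: ChesterEtAl2020, §4.2 ("rigorous error bars" `Δ_φ = 0.519088(22)`)] -/
def islandDimPhi : Set ℝ := Icc (0.519088 - 0.000022) (0.519088 + 0.000022)

/-- Go–Tachikawa's bounding box at `Λ = 25` (three external scalars, no OPE scan):
`1.50597 ≤ Δ_s ≤ 1.51547`, `0.5188 ≤ Δ_φ ≤ 0.5199`, `1.234 ≤ Δ_t ≤ 1.239` (order `(Δ_s, Δ_φ, Δ_t)`).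
[cite: GoTachikawa2019, §4.2 (eq. `1.50597 ≤ Δ_s ≤ 1.51547, 0.5188 ≤ Δ_φ ≤ 0.5199, 1.234 ≤ Δ_t ≤ 1.239`)] -/
def autobootBox25 : Set (ℝ × ℝ × ℝ) :=
  {D | D.1 ∈ Icc 1.50597 1.51547 ∧ D.2.1 ∈ Icc 0.5188 0.5199 ∧ D.2.2 ∈ Icc 1.234 1.239}

/-- The λ-point experiment's printed result `α = −0.0127 ± 0.0003` (specific-heat exponent of ⁴He in
microgravity). [cite: LipaEtAl2003, abstract and Conclusions (`α = −0.0127 ± 0.0003`)] -/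
def alphaEXP : Set ℝ := Icc (-0.0127 - 0.0003) (-0.0127 + 0.0003)

/-- `ν^EXP = 0.6709(1)`, the hyperscaling image of `alphaEXP` as quoted by the theory papers.
[cite: ChesterEtAl2020, §1.2.1 (eq. `ν^EXP = 0.6709(1)`)] [cite: Hasenbusch2025, §1 (`ν = (2−α)/d = 0.6709(1)`)] -/
def nuEXP : Set ℝ := Icc (0.6709 - 0.0001) (0.6709 + 0.0001)

/-- `ν^MC = 0.67169(7)` (improved clock model, pure Monte Carlo).
[cite: Hasenbusch2019, abstract (`ν = 0.67169(7)`)] [cite: ChesterEtAl2020, §1.2.2 (eq. `ν^MC = 0.67169(7)`)] -/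
def nuMC2019 : Set ℝ := Icc (0.67169 - 0.00007) (0.67169 + 0.00007)

/-- `ν^{MC+HT} = 0.6717(1)` (Monte Carlo combined with high-temperature series, Campostrini–Hasenbusch–
Pelissetto–Vicari 2006, as quoted). [cite: ChesterEtAl2020, §1.2.2 (eq. `ν^{MC+HT} = 0.6717(1)`)] -/
def nuMCHT2006 : Set ℝ := Icc (0.6717 - 0.0001) (0.6717 + 0.0001)

/-- `y_t = 1/ν = 1.48872(5)` (2025 lattice value, leading and subleading corrections eliminated).
[cite: Hasenbusch2025, abstract (`y_t = 1/ν = 1.48872(5)`)] -/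
def ytMC2025 : Set ℝ := Icc (1.48872 - 0.00005) (1.48872 + 0.00005)

/-- `η = 0.03816(2)` (2025 lattice value). [cite: Hasenbusch2025, abstract (`η = 0.03816(2)`)] -/
def etaMC2025 : Set ℝ := Icc (0.03816 - 0.00002) (0.03816 + 0.00002)

/-- [cite: ChesterEtAl2020, §4.2 ("rigorous error bars" `Δ_s = 1.51136(22)`)] -/
theorem islandDimS_eq : islandDimS = Icc 1.51114 1.51158 := by
  simp only [islandDimS]; norm_num

/-- [cite: ChesterEtAl2020, §4.2 ("rigorous error bars" `Δ_φ = 0.519088(22)`)] -/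
theorem islandDimPhi_eq : islandDimPhi = Icc 0.519066 0.51911 := by
  simp only [islandDimPhi]; norm_num

/-- [cite: LipaEtAl2003, abstract (`α = −0.0127 ± 0.0003`)] -/
theorem alphaEXP_eq : alphaEXP = Icc (-0.013) (-0.0124) := by
  simp only [alphaEXP]; norm_num

/-- [cite: ChesterEtAl2020, §1.2.1 (eq. `ν^EXP = 0.6709(1)`)] -/
theorem nuEXP_eq : nuEXP = Icc 0.6708 0.671 := by
  simp only [nuEXP]; norm_num

/-- [cite: ChesterEtAl2020, §4.2 ("rigorous error bars")] -/
theorem fst_mem_islandDimS {D : ℝ × ℝ × ℝ} (hD : D ∈ chesterIsland43) : D.1 ∈ islandDimS := hD.1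

/-- [cite: ChesterEtAl2020, §4.2 ("rigorous error bars")] -/
theorem snd_mem_islandDimPhi {D : ℝ × ℝ × ℝ} (hD : D ∈ chesterIsland43) : D.2.1 ∈ islandDimPhi :=
  hD.2.1

/-- The best-fit box lies inside the conservative box. [cite: ChesterEtAl2020, §4.2 ("best-fit" vs "rigorous error bars")] -/
theorem chesterIsland43BestFit_subset : chesterIsland43BestFit ⊆ chesterIsland43 := by
  rintro ⟨Δs, Δφ, Δt⟩ ⟨hs, hφ, ht⟩
  simp only [chesterIsland43, mem_setOf_eq, mem_Icc] at *
  refine ⟨⟨?_, ?_⟩, ⟨?_, ?_⟩, ⟨?_, ?_⟩⟩ <;> linarith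

/-- The `Λ = 43` conservative box lies inside the `Λ = 25` box. [cite: ChesterEtAl2020, §4.2 ("rigorous error bars")] [cite: GoTachikawa2019, §4.2 (island bounds at `Λ = 25`)] -/
theorem chesterIsland43_subset_autobootBox25 : chesterIsland43 ⊆ autobootBox25 := by
  rintro ⟨Δs, Δφ, Δt⟩ ⟨hs, hφ, ht⟩
  simp only [autobootBox25, mem_setOf_eq, mem_Icc] at *
  refine ⟨⟨?_, ?_⟩, ⟨?_, ?_⟩, ⟨?_, ?_⟩⟩ <;> linarith

/-! ## §3. The exact arithmetic of the comparison -/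

/-- The two printed forms of the experimental result agree exactly: `(2 − α)/3` maps
`[−0.0130, −0.0124]` onto `[0.6708, 0.6710]`.
[cite: LipaEtAl2003, abstract (`α = −0.0127 ± 0.0003`)] [cite: Hasenbusch2025, §1 (`ν = (2−α)/d = 0.6709(1)`)] -/
theorem nuOfAlpha_image_alphaEXP : nuOfAlpha '' alphaEXP = nuEXP := by
  ext ν
  simp only [alphaEXP, nuEXP, nuOfAlpha, mem_image, mem_Icc]
  constructor
  · rintro ⟨α, ⟨h1, h2⟩, rfl⟩
    constructor <;> linarith
  · rintro ⟨h1, h2⟩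
    exact ⟨alphaOfNu ν, ⟨by simp only [alphaOfNu]; linarith, by simp only [alphaOfNu]; linarith⟩,
      nuOfAlpha_alphaOfNu ν⟩

/-- The λ-point in dimension units: `α ∈ alphaEXP ⇒ Δ_s = 3 − 3/(2 − α) ∈ [1.50924, 1.50969]`
(exact endpoints `3 − 3/2.0124 = 1.509242…`, `3 − 3/2.0130 = 1.509687…`, rounded outward).
[cite: LipaEtAl2003, abstract (`α = −0.0127 ± 0.0003`)] [cite: ChesterEtAl2020, §4.2 ("exclude the values of `Δ_s` extracted from ⁴He measurements")] -/
theorem dimOfAlpha_mem_of_alphaEXP {α : ℝ} (hα : α ∈ alphaEXP) :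
    dimOfAlpha α ∈ Icc 1.50924 1.50969 := by
  have h := dimOfAlpha_mem_Icc (by norm_num) hα
  refine ⟨le_trans ?_ h.1, h.2.trans ?_⟩ <;> norm_num [dimOfAlpha]

/-- The island in `ν` units: `Δ_s ∈ islandDimS ⇒ ν = 1/(3 − Δ_s) ∈ [0.67165, 0.67186]` (exact
endpoints `1/1.48886 = 0.6716548…`, `1/1.48842 = 0.6718533…`; printed as `ν^CB = 0.671754(99)`).
[cite: RychkovSu2024, §4.2 (`ν^CB = 0.671754(99)`)] [cite: ChesterEtAl2020, §4.2 (`Δ_s = 1.51136(22)`)] -/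
theorem nuOfDim_mem_of_islandDimS {Δs : ℝ} (h : Δs ∈ islandDimS) :
    nuOfDim Δs ∈ Icc 0.67165 0.67186 := by
  have h' := nuOfDim_mem_Icc (by norm_num) h
  refine ⟨le_trans ?_ h'.1, h'.2.trans ?_⟩ <;> norm_num [nuOfDim]

/-- The island in `α` units: `Δ_s ∈ islandDimS ⇒ α = 2 − 3/(3 − Δ_s) ∈ [−0.01557, −0.01496]` (exact
endpoints `−0.0155601…`, `−0.0149644…`).
[cite: ChesterEtAl2020, §4.2 (`Δ_s = 1.51136(22)`)] [cite: Hasenbusch2025, §1 (`ν = (2−α)/d`)] -/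
theorem alphaOfDim_mem_of_islandDimS {Δs : ℝ} (h : Δs ∈ islandDimS) :
    alphaOfDim Δs ∈ Icc (-0.01557) (-0.01496) := by
  have h' := alphaOfDim_mem_Icc (by norm_num) h
  refine ⟨le_trans ?_ h'.1, h'.2.trans ?_⟩ <;> norm_num [alphaOfDim]

/-- The island in `η` units: `D ∈ chesterIsland43 ⇒ η = 2Δ_φ − 1 ∈ [0.038132, 0.03822]` (exact).
[cite: ChesterEtAl2020, §4.2 (`Δ_φ = 0.519088(22)`)] [cite: ChesterEtAl2020, §1.2 (relation `Δ_φ = (1+η)/2`)] -/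
theorem etaOfDim_mem_of_islandDimPhi {Δφ : ℝ} (h : Δφ ∈ islandDimPhi) :
    etaOfDim Δφ ∈ Icc 0.038132 0.03822 := by
  simp only [islandDimPhi, etaOfDim, mem_Icc] at *
  constructor <;> linarith

/-- SEPARATION with an explicit margin: every `Δ_s` of the island exceeds every λ-point `Δ_s` by at
least `0.00145` (the experimental `σ_α = 0.0003` is `≈ 0.000223` in `Δ_s` units, so the margin is
`≈ 6.5 σ` from the FAR edge of the experimental interval).
[cite: ChesterEtAl2020, §4.2 ("the conformal bootstrap results exclude the values of `Δ_s` extracted from ⁴He measurements")] [cite: LipaEtAl2003, abstract (`α = −0.0127 ± 0.0003`)] -/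
theorem lambdaPoint_gap {Δs α : ℝ} (hΔ : Δs ∈ islandDimS) (hα : α ∈ alphaEXP) :
    dimOfAlpha α + 0.00145 ≤ Δs := by
  have h1 := (dimOfAlpha_mem_of_alphaEXP hα).2
  have h2 : (1.51114 : ℝ) ≤ Δs := by rw [islandDimS_eq] at hΔ; exact hΔ.1
  linarith

/-- The island's `Δ_s`-shadow and the λ-point's `Δ_s`-interval are disjoint.
[cite: ChesterEtAl2020, §4.2 ("exclude the values of `Δ_s` extracted from ⁴He measurements")] -/
theorem disjoint_islandDimS_lambdaPoint : Disjoint islandDimS (dimOfAlpha '' alphaEXP) := by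
  rw [Set.disjoint_left]
  rintro Δs hΔ ⟨α, hα, rfl⟩
  have := lambdaPoint_gap hΔ hα
  linarith

/-- In `ν` units: no `ν` of the island lies in `ν^EXP = 0.6709(1)`.
[cite: RychkovSu2024, §4.2 ("decisively rules out the experimental measurement `ν^EXP`")] [cite: ChesterEtAl2020, §1.2.1 (eq. `ν^EXP = 0.6709(1)`)] -/
theorem nuOfDim_not_mem_nuEXP {Δs : ℝ} (h : Δs ∈ islandDimS) : nuOfDim Δs ∉ nuEXP := by
  intro hν
  have h1 := (nuOfDim_mem_of_islandDimS h).1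
  rw [nuEXP_eq] at hν
  have h2 := hν.2
  linarith

/-- In `α` units: no `α` of the island lies in `alphaEXP`.
[cite: ChesterEtAl2020, §4.2 ("exclude the values of `Δ_s` extracted from ⁴He measurements")] [cite: LipaEtAl2003, abstract (`α = −0.0127 ± 0.0003`)] -/
theorem alphaOfDim_not_mem_alphaEXP {Δs : ℝ} (h : Δs ∈ islandDimS) : alphaOfDim Δs ∉ alphaEXP := by
  intro hα
  have h1 := (alphaOfDim_mem_of_islandDimS h).2
  rw [alphaEXP_eq] at hα
  have h2 := hα.1
  linarith

/-- HOW MANY STANDARD DEVIATIONS: an `α` whose `Δ_s = 3 − 3/(2 − α)` lies in the island's shadow is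
below `α^EXP − 7σ^EXP = −0.0148` (at the shadow's near edge `α = −0.014964…`, i.e. `7.5σ`; the printed
"approximatively `8σ`" compares central values).
[cite: ChesterEtAl2020, §1.2.2 ("a large discrepancy of approximatively `8σ`")] [cite: Hasenbusch2025, §6 ("The deviation of this result from recent theoretical estimates is 8 times larger than the error that is quoted")] -/
theorem alpha_lt_of_dimOfAlpha_mem {α : ℝ} (h : dimOfAlpha α ∈ islandDimS) :
    α < -0.0127 - 7 * 0.0003 := by
  rw [islandDimS_eq] at h
  rcases le_or_gt 2 α with h2 | h2
  · -- for `α ≥ 2` the junk/negative branch gives `dimOfAlpha α ≥ 3`, outside the shadow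
    exfalso
    have h3 : 3 / (2 - α) ≤ (0 : ℝ) := div_nonpos_iff.mpr (Or.inl ⟨by norm_num, by linarith⟩)
    have h4 : (3 : ℝ) ≤ dimOfAlpha α := by simp only [dimOfAlpha]; linarith
    linarith [h.2]
  · have hmem : dimOfAlpha α ∈ islandDimS := by rw [islandDimS_eq]; exact h
    have h5 := (alphaOfDim_mem_of_islandDimS hmem).2
    rw [alphaOfDim_dimOfAlpha (ne_of_lt h2)] at h5
    linarith

/-- COMPATIBILITY (2025 lattice, `Δ_s = 3 − y_t`): `y_t = 1.48872(5)` gives `Δ_s ∈ [1.51123, 1.51133]`,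
inside the island's `Δ_s`-shadow `[1.51114, 1.51158]`.
[cite: Hasenbusch2025, abstract (`y_t = 1/ν = 1.48872(5)`)] [cite: ChesterEtAl2020, §4.2 (`Δ_s = 1.51136(22)`)] -/
theorem islandDimS_of_ytMC2025 {yt : ℝ} (h : yt ∈ ytMC2025) : dimOfNu (1 / yt) ∈ islandDimS := by
  rw [dimOfNu_one_div, islandDimS_eq]
  simp only [ytMC2025, mem_Icc] at *
  constructor <;> linarith

/-- COMPATIBILITY (2025 lattice, `η`): `η = 0.03816(2)` lies inside the island's `η`-shadow
`etaOfDim '' islandDimPhi = [0.038132, 0.03822]`.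
[cite: Hasenbusch2025, abstract (`η = 0.03816(2)`)] [cite: ChesterEtAl2020, §4.2 (`Δ_φ = 0.519088(22)`)] -/
theorem etaMC2025_subset : etaMC2025 ⊆ etaOfDim '' islandDimPhi := by
  intro η hη
  refine ⟨dimOfEta η, ?_, etaOfDim_dimOfEta η⟩
  simp only [etaMC2025, islandDimPhi, dimOfEta, mem_Icc] at *
  constructor <;> linarith

/-- COMPATIBILITY (2019 Monte Carlo): `ν^MC = 0.67169(7)` and the island meet (witness the central
value: `3 − 1/0.67169 = 1.511218…`).
[cite: Hasenbusch2019, abstract (`ν = 0.67169(7)`)] [cite: ChesterEtAl2020, §4.2 ("appear compatible with … recent results from Monte Carlo simulations")] -/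
theorem islandDimS_meets_nuMC2019 : (dimOfNu '' nuMC2019 ∩ islandDimS).Nonempty := by
  refine ⟨dimOfNu 0.67169, ⟨0.67169, ?_, rfl⟩, ?_⟩
  · simp only [nuMC2019, mem_Icc]; norm_num
  · rw [islandDimS_eq]; simp only [dimOfNu, mem_Icc]; norm_num

/-- COMPATIBILITY (2006 MC+HT): `ν^{MC+HT} = 0.6717(1)` and the island meet (witness the central value:
`3 − 1/0.6717 = 1.511240…`).
[cite: ChesterEtAl2020, §4.2 ("appear compatible with both earlier … and recent results from Monte Carlo simulations")] -/
theorem islandDimS_meets_nuMCHT2006 : (dimOfNu '' nuMCHT2006 ∩ islandDimS).Nonempty := by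
  refine ⟨dimOfNu 0.6717, ⟨0.6717, ?_, rfl⟩, ?_⟩
  · simp only [nuMCHT2006, mem_Icc]; norm_num
  · rw [islandDimS_eq]; simp only [dimOfNu, mem_Icc]; norm_num

/-- WHY THE OPE SCAN IS NEEDED: the `Λ = 25` bounding box WITHOUT OPE scan contains the entire λ-point
`Δ_s`-interval (`[1.50924, 1.50969] ⊆ [1.50597, 1.51547]`), so those bounds alone exclude nothing.
[cite: GoTachikawa2019, §4.2 (`1.50597 ≤ Δ_s ≤ 1.51547`)] [cite: RychkovSu2024, §4.2 (footnote: "[Go:2019lke] … could go only to a relatively low derivative order, not enough to solve the puzzle")] -/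
theorem lambdaPoint_subset_autobootBox25 :
    dimOfAlpha '' alphaEXP ⊆ Prod.fst '' autobootBox25 := by
  rintro _ ⟨α, hα, rfl⟩
  have h := dimOfAlpha_mem_of_alphaEXP hα
  refine ⟨(dimOfAlpha α, 0.519, 1.236), ?_, rfl⟩
  simp only [autobootBox25, mem_setOf_eq, mem_Icc] at *
  refine ⟨⟨?_, ?_⟩, ⟨?_, ?_⟩, ⟨?_, ?_⟩⟩ <;> norm_num <;> linarith [h.1, h.2]

/-! ## §4. The verdict shape -/

/-- THE VERDICT, ASSEMBLED.  Hypotheses: `hencl` — an enclosure statement *"every datum `x` obeying the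
assumptions (`Good x`) whose dimension triple `dims x = (Δ_s, Δ_φ, Δ_t)` lies in the search window `W`
has `dims x ∈ chesterIsland43`"* (the shape of `O2ThreeScalarSystem.O2Enclosure A W chesterIsland43`;
CERTIFIED only if proved from exclusion certificates — the printed island is not such a proof);
`hx`, `hW` — the PHYSICAL identification: the critical theory of the λ-transition is a datum obeying
the assumptions, with dimensions in the window.  Conclusions, by §3: its `ν = 1/(3 − Δ_s)` lies in
`[0.67165, 0.67186]` and outside `ν^EXP = 0.6709(1)`, and its `α = 2 − 3ν` lies outside
`α^EXP = −0.0127(3)`.  Which clause carries the rigour is thereby explicit.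
[cite: ChesterEtAl2020, §4.2 ("We believe that every point outside of this more conservative region is excluded by the conformal bootstrap")] [cite: RychkovSu2024, §4.2 (footnote on the non-rigorous steps)] -/
theorem verdict_of_enclosure {X : Type*} (dims : X → ℝ × ℝ × ℝ) (Good : X → Prop)
    (W : Set (ℝ × ℝ × ℝ)) (hencl : ∀ x, Good x → dims x ∈ W → dims x ∈ chesterIsland43)
    {x : X} (hx : Good x) (hW : dims x ∈ W) :
    nuOfDim (dims x).1 ∈ Icc 0.67165 0.67186 ∧ nuOfDim (dims x).1 ∉ nuEXP ∧
      alphaOfDim (dims x).1 ∉ alphaEXP := by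
  have hD : (dims x).1 ∈ islandDimS := fst_mem_islandDimS (hencl x hx hW)
  exact ⟨nuOfDim_mem_of_islandDimS hD, nuOfDim_not_mem_nuEXP hD, alphaOfDim_not_mem_alphaEXP hD⟩

/-- The same with a general target box `R`: an enclosure into `R` whose `Δ_s`-shadow lies in `[a, b]`,
`b < 3`, places `ν` in `[1/(3 − a), 1/(3 − b)]` — the form *"certified island ⇒ `ν ∈ [a′, b′]`"* for an
island other than the printed one (e.g. a coarser certified enclosure at lower `Λ`).
[cite: RychkovSu2024, §4.2 ("The found `Δ_s` translates into the critical exponent `ν`")] -/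
theorem nu_mem_of_enclosure {X : Type*} (dims : X → ℝ × ℝ × ℝ) (Good : X → Prop)
    (W R : Set (ℝ × ℝ × ℝ)) {a b : ℝ} (hb : b < 3) (hR : ∀ D ∈ R, D.1 ∈ Icc a b)
    (hencl : ∀ x, Good x → dims x ∈ W → dims x ∈ R) {x : X} (hx : Good x) (hW : dims x ∈ W) :
    nuOfDim (dims x).1 ∈ Icc (nuOfDim a) (nuOfDim b) :=
  nuOfDim_mem_Icc hb (hR _ (hencl x hx hW))

/-- … and the "outside" verdict for a general enclosure: if the target box's `Δ_s`-shadow starts above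
`1.50969`, the λ-point's `α`-interval is excluded. [cite: ChesterEtAl2020, §4.2 ("exclude the values of `Δ_s` extracted from ⁴He measurements")] [cite: LipaEtAl2003, abstract (`α = −0.0127 ± 0.0003`)] -/
theorem alpha_not_mem_of_enclosure {X : Type*} (dims : X → ℝ × ℝ × ℝ) (Good : X → Prop)
    (W R : Set (ℝ × ℝ × ℝ)) (hR : ∀ D ∈ R, (1.50969 : ℝ) < D.1)
    (hencl : ∀ x, Good x → dims x ∈ W → dims x ∈ R) {x : X} (hx : Good x) (hW : dims x ∈ W) :
    ∀ α ∈ alphaEXP, dimOfAlpha α ≠ (dims x).1 := by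
  intro α hα heq
  have h1 := (dimOfAlpha_mem_of_alphaEXP hα).2
  have h2 := hR _ (hencl x hx hW)
  rw [← heq] at h2
  linarith

/-! ## §5. The one-sided verdict `(V_c)`

The comparison with the experiment needs only a LOWER bound on `Δ_s`, not an island: *"under the
assumptions, no datum in the window has `Δ_s ≤ c`"* gives `ν > 1/(3 − c)` for the physical datum
(whose `Δ_s < 3` because `s` is relevant), and any `c ≥ 1.50969` already misses the whole λ-point
`α`-interval; the two thresholds in use are `c = 1.5097` (`1/(3 − c) = 0.67100… > ν^EXP + 1σ`) and
`c = 1.51014` (`1/(3 − c) = 0.671204… > ν^EXP + 3σ = 0.6712`). -/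

/-- ONE-SIDED VERDICT.  Hypotheses: `hexcl` — an exclusion statement *"no datum obeying the assumptions
with dimensions in the window `W` has `Δ_s ≤ c`"* (the shape of
`O2ThreeScalarSystem.BoxExcluded A {D ∈ W | D.1 ≤ c}`; certified only if proved from exclusion
certificates); `hx`, `hW` — the physical identification; `h3` — `Δ_s < 3` (the scalar `s` is relevant).
Conclusion: `ν = 1/(3 − Δ_s) > 1/(3 − c)`.
[cite: ChesterEtAl2020, §4.2 ("the conformal bootstrap results exclude the values of `Δ_s` extracted from ⁴He measurements")] [cite: RychkovSu2024, §4.2 ("The found `Δ_s` translates into the critical exponent `ν`")] -/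
theorem nuOfDim_lt_of_exclusion {X : Type*} (dims : X → ℝ × ℝ × ℝ) (Good : X → Prop)
    (W : Set (ℝ × ℝ × ℝ)) {c : ℝ} (hexcl : ∀ x, Good x → dims x ∈ W → ¬ (dims x).1 ≤ c)
    {x : X} (hx : Good x) (hW : dims x ∈ W) (h3 : (dims x).1 < 3) :
    nuOfDim c < nuOfDim (dims x).1 := by
  have hc : c < (dims x).1 := lt_of_not_ge (hexcl x hx hW)
  exact nuOfDim_strictMonoOn (show c ∈ Iio (3 : ℝ) from hc.trans h3) h3 hc

/-- … and in `α` units: if `c ≥ 1.50969` then the datum's `Δ_s` is the image of no `α ∈ alphaEXP`.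
[cite: LipaEtAl2003, abstract (`α = −0.0127 ± 0.0003`)] [cite: ChesterEtAl2020, §4.2 ("exclude the values of `Δ_s` extracted from ⁴He measurements")] -/
theorem alpha_not_mem_of_exclusion {X : Type*} (dims : X → ℝ × ℝ × ℝ) (Good : X → Prop)
    (W : Set (ℝ × ℝ × ℝ)) {c : ℝ} (hc : (1.50969 : ℝ) ≤ c)
    (hexcl : ∀ x, Good x → dims x ∈ W → ¬ (dims x).1 ≤ c)
    {x : X} (hx : Good x) (hW : dims x ∈ W) :
    ∀ α ∈ alphaEXP, dimOfAlpha α ≠ (dims x).1 := by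
  intro α hα heq
  have h1 := (dimOfAlpha_mem_of_alphaEXP hα).2
  have h2 : c < (dims x).1 := lt_of_not_ge (hexcl x hx hW)
  rw [← heq] at h2
  linarith

/-- The `1σ` threshold: `c = 1.5097` gives `1/(3 − c) = 0.671006… > 0.6710 = ν^EXP + 1σ`, and
`1.5097` exceeds every λ-point `Δ_s` (`≤ 1.50969`).
[cite: ChesterEtAl2020, §1.2.1 (eq. `ν^EXP = 0.6709(1)`)] [cite: LipaEtAl2003, abstract (`α = −0.0127 ± 0.0003`)] -/
theorem threshold_one_sigma :
    (0.6709 + 0.0001 : ℝ) < nuOfDim 1.5097 ∧ ∀ α ∈ alphaEXP, dimOfAlpha α < 1.5097 := by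
  refine ⟨by norm_num [nuOfDim], fun α hα => ?_⟩
  have h := (dimOfAlpha_mem_of_alphaEXP hα).2
  linarith

/-- The `3σ` threshold: `c = 1.51014` gives `1/(3 − c) = 0.671204… > 0.6712 = ν^EXP + 3σ`; equivalently
every `α` with `α ≥ α^EXP − 3σ^EXP = −0.0136` has `Δ_s = 3 − 3/(2 − α) < 1.51014` (value at `−0.0136`:
`1.510131…`).
[cite: ChesterEtAl2020, §1.2.1 (eq. `ν^EXP = 0.6709(1)`)] [cite: LipaEtAl2003, abstract (`α = −0.0127 ± 0.0003`)] [cite: Hasenbusch2025, §1 (`ν = (2−α)/d`)] -/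
theorem threshold_three_sigma :
    (0.6709 + 3 * 0.0001 : ℝ) < nuOfDim 1.51014 ∧
      ∀ α ∈ Icc (-0.0127 - 3 * 0.0003 : ℝ) 1, dimOfAlpha α < 1.51014 := by
  refine ⟨by norm_num [nuOfDim], fun α hα => ?_⟩
  have h := (dimOfAlpha_mem_Icc (show (1 : ℝ) < 2 by norm_num) hα).2
  exact lt_of_le_of_lt h (by norm_num [dimOfAlpha])

/-! ## §6. The charge-2 scalar: `Δ_t` versus the lattice RG exponent `Y₂`

The third coordinate of the island is compared in the literature through the RG exponent of the
charge-2 (anisotropy) perturbation, `Y₂ = 3 − Δ_t`: Monte Carlo gives `Y₂ = 1.7639(11)`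
(Hasenbusch–Vicari 2011, as quoted in [Hasenbusch2025, §3]) and the bootstrap island gives
`Y₂ = 1.76371(11)`, i.e. `Δ_t = 1.23629(11)` [ChesterEtAl2020, §4.2].  The exact statement: the
`Δ_t`-shadow of the island lies INSIDE the Monte-Carlo interval (consistency, no tension in this
coordinate). -/

/-- The `Δ_t`-shadow of `chesterIsland43`: `Δ_t = 1.23629(11)`.
[cite: ChesterEtAl2020, §4.2 ("rigorous error bars" `Δ_t = 1.23629(11)`)] -/
def islandDimT : Set ℝ := Icc (1.23629 - 0.00011) (1.23629 + 0.00011)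

/-- [cite: ChesterEtAl2020, §4.2 ("rigorous error bars" `Δ_t = 1.23629(11)`)] -/
theorem islandDimT_eq : islandDimT = Icc 1.23618 1.2364 := by
  simp only [islandDimT]; norm_num

/-- [cite: ChesterEtAl2020, §4.2 ("rigorous error bars")] -/
theorem third_mem_islandDimT {D : ℝ × ℝ × ℝ} (hD : D ∈ chesterIsland43) : D.2.2 ∈ islandDimT :=
  hD.2.2

/-- The Monte-Carlo RG exponent of the charge-2 perturbation, `Y₂ = 1.7639(11)` (Hasenbusch–Vicari
2011), as quoted in the 2025 lattice paper. [cite: Hasenbusch2025, §3 (`Y_2 = 1.7639(11)`, Ref. [O234])] -/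
def y2MC2011 : Set ℝ := Icc (1.7639 - 0.0011) (1.7639 + 0.0011)

/-- The RG exponent of a scalar of dimension `Δ` in `d = 3`: `y = 3 − Δ`.
[cite: Hasenbusch2025, §3 (`Y_2 = 3 − Δ_t`: bootstrap `Y_2 = 1.76371(11)` from `Δ_t = 1.23629(11)`)] -/
def rgOfDim (Δ : ℝ) : ℝ := 3 - Δ

/-- [cite: Hasenbusch2025, §3 (`y = 3 − Δ`)] -/
theorem rgOfDim_rgOfDim (Δ : ℝ) : rgOfDim (rgOfDim Δ) = Δ := by simp [rgOfDim]

/-- The bootstrap value of `Y₂` printed in [Hasenbusch2025, §3] is exactly `3 − (island Δ_t-shadow)`: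
`rgOfDim '' islandDimT = [1.7636, 1.76382] = 1.76371(11)`.
[cite: Hasenbusch2025, §3 (`Y_2 = 1.76371(11)`, Ref. [che19])] [cite: ChesterEtAl2020, §4.2 (`Δ_t = 1.23629(11)`)] -/
theorem rgOfDim_image_islandDimT :
    rgOfDim '' islandDimT = Icc (1.76371 - 0.00011) (1.76371 + 0.00011) := by
  ext y
  simp only [islandDimT, rgOfDim, Set.mem_image, mem_Icc]
  constructor
  · rintro ⟨Δ, ⟨h1, h2⟩, rfl⟩
    constructor <;> linarith
  · rintro ⟨h1, h2⟩
    exact ⟨3 - y, ⟨by linarith, by linarith⟩, by ring⟩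

/-- Consistency in the third coordinate: every `Δ_t` in the island shadow has its RG exponent
`3 − Δ_t` inside the Monte-Carlo interval `Y₂ = 1.7639(11)` (indeed `[1.7636, 1.76382] ⊆ [1.7628, 1.765]`).
[cite: Hasenbusch2025, §3 (`Y_2 = 1.7639(11)` vs `1.76371(11)`)] [cite: ChesterEtAl2020, §4.2 (`Δ_t = 1.23629(11)`)] -/
theorem rgOfDim_mem_y2MC2011 {Δt : ℝ} (h : Δt ∈ islandDimT) : rgOfDim Δt ∈ y2MC2011 := by
  simp only [islandDimT, y2MC2011, rgOfDim, mem_Icc] at *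
  constructor <;> linarith

/-- Packaged with an enclosure hypothesis (shape of `O2Enclosure A W chesterIsland43`): the critical
theory's `Δ_t` has RG exponent inside the Monte-Carlo `Y₂`-interval.
[cite: ChesterEtAl2020, §4.2 (`Δ_t = 1.23629(11)`)] [cite: Hasenbusch2025, §3 (`Y_2 = 1.7639(11)`)] -/
theorem y2_mem_of_enclosure {X : Type*} (dims : X → ℝ × ℝ × ℝ) (Good : X → Prop)
    (W : Set (ℝ × ℝ × ℝ)) (hencl : ∀ x, Good x → dims x ∈ W → dims x ∈ chesterIsland43) {x : X}
    (hx : Good x) (hW : dims x ∈ W) : rgOfDim (dims x).2.2 ∈ y2MC2011 :=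
  rgOfDim_mem_y2MC2011 (third_mem_islandDimT (hencl x hx hW))

end Literature.MathematicalPhysics.QuantumFieldTheory.O2CriticalExponents
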